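import Summits.AtomisticToContinuum.FouriersLaw.Theses.PhononMeanFreePath
import Summits.AtomisticToContinuum.FouriersLaw.Theorems.BoundaryKubo.Negative.LoadBearing
import Literature.MathematicalPhysics.KineticTheory.LangevinSemigroupHarris

/-!
# Locally uniform Harris bounds, helper 2: Harris' theorem and the passage to continuous time with explicit constants
(helpers for stub `stub_uniformHarris_of_minorization` of line `gibbs-ttcf`, crux stmt-AtomisticToContinuum-11812
`PhononMeanFreePath.BoundaryKubo`)

The tree's Harris theorem (`Literature.Probability.Process.Harris.harris`, Hairer–Mattingly 2011) and the
continuous-time step of CEHR 2018 Prop. 3.8 (`LangevinChainSemigroup.exp_convergence_of_H2_of_minorization`)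
return their rate constants existentially, per kernel / per semigroup. Both proofs are explicit; here they are
re-threaded with the witnesses exposed, so that a FAMILY of kernels sharing the drift constants `(γ, K)` and the
minorisation constants `(α, R)` (but not the minorising measure) gets ONE pair `(ᾱ, β)`, and a family of
semigroups sharing `(ϑ, C_*, m, ᾱ, b)` and a moment bound gets ONE pair `(C, c)`:

* `harris_uniform` — for fixed `γ < 1`, `α > 0`, `R > 2K/(1-γ)`: `ᾱ = (1-α/2) ∨ γ ∨ (2+Rβγ₀)/(2+Rβ)`,
  `β = α/(2(K+1))` work for EVERY Markov kernel with drift `PV ≤ γV + K` minorised by `αν` on `{V ≤ R}`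
  (uniqueness of the invariant probability measure, `∫V dμ ≤ K/(1-γ)`, geometric convergence);
* `semigroup_exp_convergence_explicit` — CEHR (2.5) for a `LangevinChainSemigroup` from the skeleton bound at
  time `m` and (3.4), with `C = (b⁻¹(2 + b M) + 1) e^{C_* m}/ᾱ`, `c = -log ᾱ/m`;
* `uniformHarris_harrisUniform` (registered sub-goal) — `harris_uniform` on phase space.
-/

noncomputable section

open scoped NNReal ENNReal Topology
open MeasureTheory Filter Set

namespace Summit.AtomisticToContinuum.FouriersLaw.Theorems.BoundaryKubo.GibbsTtcf

open Literature.MathematicalPhysics.KineticTheory.HeatConduction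
open Literature.MathematicalPhysics.KineticTheory Literature.Probability.Process OscillatorChain
open ProbabilityTheory

/-- **Harris' theorem (Hairer–Mattingly 2011, Thms 1.2–1.3) with constants uniform over a family of
kernels.** For `γ < 1`, `α > 0` and `R` with `2K < (1-γ)R` there are `ᾱ ∈ (0,1)` and `β > 0` (namely
`β = α/(2(K+1))`, `ᾱ = (1 - α + α/2) ∨ γ ∨ (2 + βR(γ + 2K/R))/(2 + βR)`) such that EVERY Markov kernel `P`
with a measurable `V ≥ 0`, `PV ≤ γV + K` and `P(x,·) ≥ αν` on `{V ≤ R}` for some probability measure `ν` has: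
at most one invariant probability measure; `∫ V dμ ≤ K/(1-γ)` and
`|Pⁿφ(x) - μ(φ)| ≤ ᾱⁿ(2 + βV(x) + βμ(V))` for `|φ| ≤ 1 + βV`, for every invariant probability measure `μ`
(the tree's `Harris.abs_integral_sub_integral_le` with its printed constants, then `invariant_unique`,
`lintegral_le_of_invariant`, `abs_integral_pow_sub_integral_le`). [cite: HairerMattingly2011, Theorems 1.2 and 1.3] -/
theorem harris_uniform {X : Type*} [MeasurableSpace X] {γ K α R : ℝ≥0} (hγ : γ < 1) (hα : 0 < α)
    (hR : 2 * K < (1 - γ) * R) :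
    ∃ abar β : ℝ, 0 < abar ∧ abar < 1 ∧ 0 < β ∧
      ∀ (P : Kernel X X), IsMarkovKernel P → ∀ V : X → ℝ≥0, Measurable V →
        (∀ x, ∫⁻ y, V y ∂(P x) ≤ (γ : ℝ≥0∞) * V x + K) →
        ∀ ν : Measure X, IsProbabilityMeasure ν → (∀ x, V x ≤ R → α • ν ≤ P x) →
          (∀ μ₁ μ₂ : Measure X, IsProbabilityMeasure μ₁ → IsProbabilityMeasure μ₂ →
              Kernel.Invariant P μ₁ → Kernel.Invariant P μ₂ → μ₁ = μ₂) ∧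
          ∀ μ : Measure X, IsProbabilityMeasure μ → Kernel.Invariant P μ →
            ∫⁻ x, (V x : ℝ≥0∞) ∂μ ≤ ((K / (1 - γ) : ℝ≥0) : ℝ≥0∞) ∧
            ∀ (n : ℕ) (φ : X → ℝ), Measurable φ → (∀ x, |φ x| ≤ 1 + β * V x) → ∀ x,
              |∫ z, φ z ∂((P ^ n) x) - ∫ z, φ z ∂μ| ≤
                abar ^ n * (2 + β * V x + β * (∫⁻ z, (V z : ℝ≥0∞) ∂μ).toReal) := by
  -- `α₀ = α/2`, `β = α/(2(K+1))`, so that `βK ≤ α₀ < α`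
  set α₀ : ℝ := α / 2 with hα₀
  set β : ℝ := α / (2 * (K + 1)) with hβdef
  have hα' : (0 : ℝ) < α := by exact_mod_cast hα
  have hK0 : (0 : ℝ) ≤ K := K.coe_nonneg
  have hβ : 0 < β := by positivity
  have hβK : β * K ≤ α₀ := by
    rw [hβdef, hα₀, div_mul_eq_mul_div, div_le_div_iff₀ (by positivity) (by positivity)]
    nlinarith
  have hα₀α : α₀ < α := by rw [hα₀]; linarith
  have h0 := Harris.contractionFactor_pos (γ := γ) (K := K) (α := α) (R := R) (α₀ := α₀) hβ
  have h1 := Harris.contractionFactor_lt_one hγ hR hα₀α hβ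
  refine ⟨max (max (1 - α + α₀) γ) ((2 + β * R * (γ + 2 * K / R)) / (2 + β * R)), β, h0, h1, hβ,
    fun P hP V hV hdrift ν hν hminor => ?_⟩
  have hcontr : ∀ (φ : X → ℝ), Measurable φ → ∀ M : ℝ, 0 ≤ M →
      (∀ x y, |φ x - φ y| ≤ M * (2 + β * V x + β * V y)) →
      ∀ x y, |∫ z, φ z ∂(P x) - ∫ z, φ z ∂(P y)| ≤
        max (max (1 - α + α₀) γ) ((2 + β * R * (γ + 2 * K / R)) / (2 + β * R)) * M *
          (2 + β * V x + β * V y) :=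
    fun φ hφm M hM hφ x y => Harris.abs_integral_sub_integral_le P hV hγ hdrift hR hminor hβ hβK hφm hM hφ x y
  refine ⟨fun μ₁ μ₂ _ _ hμ₁ hμ₂ => Harris.invariant_unique P hV hγ hdrift hβ.le hcontr h0.le h1 hμ₁ hμ₂,
    fun μ _ hμ => ⟨Harris.lintegral_le_of_invariant P hV hγ hdrift hμ, fun n φ hφm hφ x => ?_⟩⟩
  have hLip : ∀ x y, |φ x - φ y| ≤ (1 : ℝ) * (2 + β * V x + β * V y) := by
    intro x y
    have := abs_sub (φ x) (φ y)
    linarith [hφ x, hφ y]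
  simpa using Harris.abs_integral_pow_sub_integral_le P hV hγ hdrift hcontr h0.le hμ n hφm zero_le_one
    hLip x

/-- **CEHR Theorem 2.13 (3) / Prop. 3.8, the passage from the skeleton to continuous time, with explicit
constants.** Let `S` be a Markov semigroup of an oscillator chain with `H ≥ 0` continuous, `ϑ > 0`, the
a-priori bound (3.4) `∫ e^{ϑH} dP_t(z,·) ≤ e^{C_* t} e^{ϑH(z)}` (`C_* ≥ 0`), and suppose the skeleton `P_m`
(`m ≥ 1`) converges geometrically to a probability measure `μ` in Harris' form:
`|P_mⁿ φ(x) - μ(φ)| ≤ ᾱⁿ(2 + b e^{ϑH(x)} + b μ(e^{ϑH}))` for `|φ| ≤ 1 + b e^{ϑH}`, with `ᾱ ∈ (0,1)`, `b > 0`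
and `μ(e^{ϑH}) ≤ M`. Then for all `z`, `t ≥ 0` and continuous `|f| ≤ e^{ϑH}`:
`|P_t f(z) - μ(f)| ≤ C e^{ϑH(z)} e^{-ct}` with `C = (b⁻¹(2 + bM) + 1) e^{C_* m}/ᾱ` and `c = -log ᾱ / m`
(printed proof: `t = n m + r`, Markov property, (3.4) on `r < m`, `ᾱⁿ ≤ ᾱ⁻¹e^{-ct}`).
[cite: CuneoEckmannHairerReyBellet2018, Thm 2.13 (3) and Prop 3.8] -/
theorem semigroup_exp_convergence_explicit {P : OscillatorChain} {N : ℕ} {T_L T_R : ℝ}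
    (S : LangevinChainSemigroup P N T_L T_R) (hHc : Continuous (P.hamiltonian N))
    (hH0 : ∀ z, 0 ≤ P.hamiltonian N z) {ϑ Cs : ℝ} (hϑ0 : 0 < ϑ) (hCs : 0 ≤ Cs)
    (h34 : ∀ (t : ℝ≥0) (z : PhaseSpace N),
      ∫⁻ y, ENNReal.ofReal (Real.exp (ϑ * P.hamiltonian N y)) ∂(S.kernel t z) ≤
        ENNReal.ofReal (Real.exp (Cs * t) * Real.exp (ϑ * P.hamiltonian N z)))
    {m : ℕ} (hm : 0 < m) {abar b Mb : ℝ} (ha0 : 0 < abar) (ha1 : abar < 1) (hb : 0 < b) (hMb : 0 ≤ Mb)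
    (μ : Measure (PhaseSpace N)) [IsProbabilityMeasure μ]
    (hμV : (∫⁻ z, ENNReal.ofReal (Real.exp (ϑ * P.hamiltonian N z)) ∂μ).toReal ≤ Mb)
    (hgeo : ∀ (n : ℕ) (φ : PhaseSpace N → ℝ), Measurable φ →
      (∀ x, |φ x| ≤ 1 + b * Real.exp (ϑ * P.hamiltonian N x)) →
      ∀ x, |∫ z, φ z ∂((S.kernel m ^ n) x) - ∫ z, φ z ∂μ| ≤
        abar ^ n * (2 + b * Real.exp (ϑ * P.hamiltonian N x) +
          b * (∫⁻ z, ENNReal.ofReal (Real.exp (ϑ * P.hamiltonian N z)) ∂μ).toReal))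
    (z : PhaseSpace N) (t : ℝ≥0) (f : PhaseSpace N → ℝ) (hf : Continuous f)
    (hfV : ∀ y, |f y| ≤ Real.exp (ϑ * P.hamiltonian N y)) :
    |S.act t f z - ∫ y, f y ∂μ| ≤
      (b⁻¹ * (2 + b * Mb) + 1) * Real.exp (Cs * m) / abar * Real.exp (ϑ * P.hamiltonian N z) *
        Real.exp (-(-Real.log abar / m) * t) := by
  set Hm := P.hamiltonian N with hHm
  -- notation
  set V : PhaseSpace N → ℝ≥0 := fun z => (Real.exp (ϑ * Hm z)).toNNReal with hVdef
  have hVc : Continuous V := continuous_real_toNNReal.comp (Real.continuous_exp.comp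
    (continuous_const.mul hHc))
  have hV : Measurable V := hVc.measurable
  have hVcoe : ∀ z, (V z : ℝ≥0∞) = ENNReal.ofReal (Real.exp (ϑ * Hm z)) := fun z => rfl
  have hVreal : ∀ z, (V z : ℝ) = Real.exp (ϑ * Hm z) := fun z =>
    Real.coe_toNNReal _ (Real.exp_pos _).le
  have hV1 : ∀ z, 1 ≤ Real.exp (ϑ * Hm z) := fun z => Real.one_le_exp (mul_nonneg hϑ0.le (hH0 z))
  set t₀ : ℝ≥0 := (m : ℝ≥0) with ht₀def
  have ht₀ : 0 < t₀ := by rw [ht₀def]; exact_mod_cast hm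
  set Pk : Kernel (PhaseSpace N) (PhaseSpace N) := S.kernel t₀ with hPdef
  have ht₀r : (0 : ℝ) < t₀ := by exact_mod_cast ht₀
  have ht₀m : ((t₀ : ℝ≥0) : ℝ) = m := by rw [ht₀def]; exact NNReal.coe_natCast m
  set mV : ℝ := (∫⁻ z, ENNReal.ofReal (Real.exp (ϑ * Hm z)) ∂μ).toReal with hmV
  have hmV0 : 0 ≤ mV := ENNReal.toReal_nonneg
  have hb0 : b ≠ 0 := hb.ne'
  set C₁ : ℝ := b⁻¹ * (2 + b * Mb) + 1 with hC₁def
  have hC₁ : 0 < C₁ := by rw [hC₁def]; positivity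
  set c : ℝ := -Real.log abar / t₀ with hcdef
  have hlog : Real.log abar < 0 := Real.log_neg ha0 ha1
  have hc : 0 < c := by rw [hcdef]; exact div_pos (by linarith) ht₀r
  show |S.act t f z - ∫ y, f y ∂μ| ≤ C₁ * Real.exp (Cs * m) / abar * Real.exp (ϑ * Hm z) *
    Real.exp (-(-Real.log abar / m) * t)
  rw [← ht₀m]
  -- finiteness of the `V`-moments along the semigroup, (3.4)
  have h34' : ∀ (s : ℝ≥0) (x : PhaseSpace N), ∫⁻ y, (V y : ℝ≥0∞) ∂(S.kernel s x) ≠ ∞ :=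
    fun s x => ne_top_of_le_ne_top ENNReal.ofReal_ne_top (h34 s x)
  have hfm : Measurable f := hf.measurable
  have hfV' : ∀ y, |f y| ≤ 0 + 1 * V y := fun y => by rw [hVreal, zero_add, one_mul]; exact hfV y
  have hfint : ∀ (s : ℝ≥0) (x : PhaseSpace N), Integrable f (S.kernel s x) := fun s x =>
    Harris.integrable_of_abs_le_affine hV (h34' s x) hfm hfV'
  -- Harris on the skeleton: `|Pⁿ f(x) - μ(f)| ≤ ᾱⁿ C₁ e^{ϑH(x)}`
  have hskel : ∀ (n : ℕ) (x : PhaseSpace N),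
      |∫ y, f y ∂((Pk ^ n) x) - ∫ y, f y ∂μ| ≤ abar ^ n * C₁ * Real.exp (ϑ * Hm x) := by
    intro n x
    have hφm : Measurable fun y => b * f y := hfm.const_mul b
    have hφ : ∀ y, |b * f y| ≤ 1 + b * Real.exp (ϑ * Hm y) := fun y => by
      rw [abs_mul, abs_of_pos hb]
      have := mul_le_mul_of_nonneg_left (hfV y) hb.le
      linarith
    have h := hgeo n (fun y => b * f y) hφm hφ x
    rw [integral_const_mul, integral_const_mul, ← mul_sub, abs_mul, abs_of_pos hb] at h
    have h' : |∫ y, f y ∂((Pk ^ n) x) - ∫ y, f y ∂μ| ≤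
        abar ^ n * (b⁻¹ * (2 + b * mV) + Real.exp (ϑ * Hm x)) := by
      have h1 := mul_le_mul_of_nonneg_left h (inv_nonneg.2 hb.le)
      rw [inv_mul_cancel_left₀ hb0] at h1
      refine h1.trans (le_of_eq ?_)
      rw [hmV]
      field_simp
      ring
    refine h'.trans ?_
    rw [mul_assoc]
    refine mul_le_mul_of_nonneg_left ?_ (pow_nonneg ha0.le n)
    have hE := hV1 x
    have hpos : 0 ≤ b⁻¹ * (2 + b * Mb) := by positivity
    have hmon : b⁻¹ * (2 + b * mV) ≤ b⁻¹ * (2 + b * Mb) :=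
      mul_le_mul_of_nonneg_left (by nlinarith [hμV, hb]) (inv_nonneg.2 hb.le)
    rw [hC₁def]
    nlinarith [mul_nonneg hpos (sub_nonneg.2 hE)]
  -- `t = r + n t₀`, `r < t₀`
  obtain ⟨n, r, hr, rfl⟩ := exists_eq_add_nat_mul_of_pos ht₀ t
  -- the Markov property: `P_t f(z) = ∫ Pⁿ f(y) P_r(z, dy)`
  set g : PhaseSpace N → ℝ := fun y => ∫ w, f w ∂((Pk ^ n) y) with hg
  have hgm : Measurable g := (hfm.stronglyMeasurable.integral_kernel (κ := Pk ^ n)).measurable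
  have hact : S.act (r + n * t₀) f z = ∫ y, g y ∂(S.kernel r z) := by
    have hint : Integrable f (((Pk ^ n) ∘ₖ S.kernel r) z) := by
      have := hfint (r + n * t₀) z
      rwa [S.kernel_add, S.kernel_nat_mul] at this
    rw [LangevinChainSemigroup.act_apply, S.kernel_add, S.kernel_nat_mul, ← hPdef]
    rw [Kernel.comp_apply] at hint ⊢
    exact Harris.integral_comp_measure (Pk ^ n) (S.kernel r z) hint
  rw [hact]
  -- integrate the skeleton bound against `P_r(z, ·)`
  have hgb : ∀ y, |g y - ∫ w, f w ∂μ| ≤ abar ^ n * C₁ * Real.exp (ϑ * Hm y) := fun y => hskel n y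
  have hgi : Integrable g (S.kernel r z) := by
    refine Harris.integrable_of_abs_le_affine hV (h34' r z) hgm (A := |∫ w, f w ∂μ|)
      (B := abar ^ n * C₁) fun y => ?_
    have h1 := hgb y
    rw [hVreal]
    have h2 : |g y| ≤ |∫ w, f w ∂μ| + |g y - ∫ w, f w ∂μ| := by
      have := abs_add_le (∫ w, f w ∂μ) (g y - ∫ w, f w ∂μ); rwa [add_sub_cancel] at this
    linarith
  have hVi : Integrable (fun y => (V y : ℝ)) (S.kernel r z) :=
    Harris.integrable_coe_of_lintegral_ne_top hV (h34' r z)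
  have hsub : (∫ y, g y ∂(S.kernel r z)) - ∫ w, f w ∂μ =
      ∫ y, (g y - ∫ w, f w ∂μ) ∂(S.kernel r z) := by
    rw [integral_sub hgi (integrable_const _), integral_const, probReal_univ, one_smul]
  have hPr : (∫⁻ y, (V y : ℝ≥0∞) ∂(S.kernel r z)).toReal ≤
      Real.exp (Cs * t₀) * Real.exp (ϑ * Hm z) := by
    refine (ENNReal.toReal_le_of_le_ofReal (by positivity) (h34 r z)).trans ?_
    refine mul_le_mul_of_nonneg_right (Real.exp_le_exp.2 ?_) (Real.exp_pos _).le
    exact mul_le_mul_of_nonneg_left (by exact_mod_cast hr.le) hCs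
  -- `ᾱⁿ ≤ ᾱ⁻¹ e^{-ct}`
  have hpow : abar ^ n ≤ abar⁻¹ * Real.exp (-c * ((r + n * t₀ : ℝ≥0) : ℝ)) := by
    have hlogeq : Real.log abar = -c * t₀ := by
      rw [hcdef, neg_mul, div_mul_cancel₀ _ ht₀r.ne', neg_neg]
    have hn : abar ^ n = Real.exp (n * Real.log abar) := by
      rw [Real.exp_nat_mul, Real.exp_log ha0]
    have hinv' : abar⁻¹ = Real.exp (c * t₀) := by
      have : Real.exp (c * t₀) = Real.exp (-Real.log abar) := by
        rw [hlogeq]; simp only [neg_mul, neg_neg]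
      rw [this, Real.exp_neg, Real.exp_log ha0]
    rw [hn, hinv', ← Real.exp_add]
    refine Real.exp_le_exp.2 ?_
    rw [hlogeq]
    push_cast
    have hr' : ((r : ℝ≥0) : ℝ) ≤ t₀ := by exact_mod_cast hr.le
    have hc0 : 0 ≤ c := hc.le
    nlinarith [mul_nonneg hc0 (sub_nonneg.2 hr')]
  calc |(∫ y, g y ∂(S.kernel r z)) - ∫ w, f w ∂μ|
      = |∫ y, (g y - ∫ w, f w ∂μ) ∂(S.kernel r z)| := by rw [hsub]
    _ ≤ ∫ y, |g y - ∫ w, f w ∂μ| ∂(S.kernel r z) := abs_integral_le_integral_abs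
    _ ≤ ∫ y, abar ^ n * C₁ * (V y : ℝ) ∂(S.kernel r z) := by
        refine integral_mono (hgi.sub (integrable_const _)).abs (hVi.const_mul _) fun y => ?_
        have := hgb y
        rwa [← hVreal] at this
    _ = abar ^ n * C₁ * (∫⁻ y, (V y : ℝ≥0∞) ∂(S.kernel r z)).toReal := by
        rw [integral_const_mul, Harris.integral_coe_eq_toReal hV]
    _ ≤ abar ^ n * C₁ * (Real.exp (Cs * t₀) * Real.exp (ϑ * Hm z)) :=
        mul_le_mul_of_nonneg_left hPr (by positivity)
    _ ≤ (abar⁻¹ * Real.exp (-c * ((r + n * t₀ : ℝ≥0) : ℝ))) * C₁ *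
          (Real.exp (Cs * t₀) * Real.exp (ϑ * Hm z)) := by
        gcongr
    _ = C₁ * Real.exp (Cs * t₀) / abar * Real.exp (ϑ * Hm z) *
          Real.exp (-c * ((r + n * t₀ : ℝ≥0) : ℝ)) := by
        ring

/-- **Registered sub-goal `uniformHarris_harrisUniform`** of crux stmt-AtomisticToContinuum-11812 (under
`stub_uniformHarris_of_minorization`, line `gibbs-ttcf`): `harris_uniform` for Markov kernels on the phase space
of an `N`-site chain — Harris' theorem with one pair `(ᾱ, β)` for all kernels sharing `(γ, K, α, R)`.
[cite: HairerMattingly2011, Theorems 1.2 and 1.3] -/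
theorem uniformHarris_harrisUniform :
    ∀ (N : ℕ) (γ K α R : ℝ≥0), γ < 1 → 0 < α → 2 * K < (1 - γ) * R → ∃ abar β : ℝ, 0 < abar ∧ abar < 1 ∧ 0 < β ∧ ∀ (P : ProbabilityTheory.Kernel (PhaseSpace N) (PhaseSpace N)), ProbabilityTheory.IsMarkovKernel P → ∀ V : PhaseSpace N → ℝ≥0, Measurable V → (∀ x, ∫⁻ y, (V y : ℝ≥0∞) ∂(P x) ≤ (γ : ℝ≥0∞) * V x + K) → ∀ ν : Measure (PhaseSpace N), IsProbabilityMeasure ν → (∀ x, V x ≤ R → α • ν ≤ P x) → (∀ μ₁ μ₂ : Measure (PhaseSpace N), IsProbabilityMeasure μ₁ → IsProbabilityMeasure μ₂ → ProbabilityTheory.Kernel.Invariant P μ₁ → ProbabilityTheory.Kernel.Invariant P μ₂ → μ₁ = μ₂) ∧ ∀ μ : Measure (PhaseSpace N), IsProbabilityMeasure μ → ProbabilityTheory.Kernel.Invariant P μ → ∫⁻ x, (V x : ℝ≥0∞) ∂μ ≤ ((K / (1 - γ) : ℝ≥0) : ℝ≥0∞) ∧ ∀ (n : ℕ) (φ :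 PhaseSpace N → ℝ), Measurable φ → (∀ x, |φ x| ≤ 1 + β * V x) → ∀ x, |∫ z, φ z ∂((P ^ n) x) - ∫ z, φ z ∂μ| ≤ abar ^ n * (2 + β * V x + β * (∫⁻ z, (V z : ℝ≥0∞) ∂μ).toReal) :=
  fun _ _ _ _ _ hγ hα hR => harris_uniform hγ hα hR

end Summit.AtomisticToContinuum.FouriersLaw.Theorems.BoundaryKubo.GibbsTtcf

end
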